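/-
Copyright: statement-level skeleton of a published paper (lit-balaban cell, Phase-2 proof seat p13, gen 6). No proof
claims beyond what the kernel checks below.
-/
import Mathlib.Combinatorics.SimpleGraph.Connectivity.Connected
import Literature.MathematicalPhysics.QuantumFieldTheory.BalabanImbrieJaffe1984to88.BIJ88DirichletForms305

/-!
# `BalabanImbrieJaffe1984to88.BIJ88CsClusters306` — T. Bałaban, J. Imbrie, A. Jaffe, *Effective action and cluster
properties of the abelian Higgs model*, Commun. Math. Phys. **114** (1988) 257–315 [BalabanImbrieJaffe1988], §5.13
p. 306 [PDF 50]: **the factorization of the interpolated Gaussian over CLUSTERS** — *"only adjacent □_j with s_j ≠ 0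
interact … factorizes over the connected components of Γ … also factorizes over the □_{i′}, i′ ∈ I∖Γ"* — PROVED AT
THE LEVEL OF THE COVARIANCE: the interpolated form `Δ_s` of p. 305 couples two different elementary regions only
through `s_is_{i′}□_iΔ□_{i′}`, so it is block-diagonal over the clusters, and THE INVERSE OF A CLUSTER-BLOCK-DIAGONAL
MATRIX IS CLUSTER-BLOCK-DIAGONAL: `C_s = (−Δ_s)^{−1}` does not couple different clusters.

statement-level skeleton of published theorems with citation tags; proofs where landed; nothing here is a claim
about the Yang–Mills mass gap

PDF held: `paper:balaban1988-cmp114-bij-abelian-higgs-effective-action` (journal page = PDF page + 256; pp. 305–306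
read with `lit read … --pages 49-50`).

CITATION HEADER (lean-in-tree rule).  lit-balaban cell (HOME `run/shared/lean/pub/lit-balaban/`), Phase 2, seat p13
gen 6 (unit `lit-balaban-p13-g6`); companion of `…BIJ88CsDecay305` (p254974: `C_s` exists and decays exponentially,
uniformly in `s`); row **C2.Eq5.13.3-5.13.4** of `HOME/lit-balaban-r16/ROWS-C2-part2.md` (owner r16, referee ref-5),
the p. 306 members «factorization over the connected components of Γ / over the □_{i′}, i′ ∈ I∖Γ; clusters».  Files
USED BY NAME, nothing restated: `…BIJ88DirichletForms305` (seat p02 gen 4, p252603: `dirichletForm`,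
`dirichletForm_apply`, `interpForm`, `interpForm_apply`); Mathlib (`Matrix.inv`, `SimpleGraph.ConnectedComponent`).

## The print (verbatim, p. 306; the objects of p. 305)

p. 305: *"Δ_Γ = Σ_{i∈Γ} □_iΔ□_i + □^cΔ□^c … Δ_s = Σ_{Γ⊂I} Π_{i∈Γ}(1 − s_i) Π_{i∈I∖Γ} s_i Δ_Γ … □_iΔ_s□_{i′} =
s_is_{i′}□_iΔ□_{i′}, i′ ≠ i, □_iΔ_s□_i = □_iΔ□_i … C_s = (−Δ_s)^{−1} … Here s_Γ specifies s_i = 0 for i ∉ Γ"*.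
p. 306: *"Let us examine the factorization properties of this expansion. The form Δ has a range less than ½r(e_k).
The f(□_i) do not couple different □_i. Hence only adjacent □_j with s_j ≠ 0 interact in the above formula. Thus our
expression for ∂/∂s_Γ ⟨Π_{i∈I} f(□_i)⟩_{s_Γ} factorizes over the connected components of Γ. (Here we say that □_i is
connected to □_{i′} if they abut on a hypersurface of any dimension.) The expression also factorizes over the □_{i′},
i′ ∈ I∖Γ. Call the factorization regions clusters."*

## What is proved (0 `sorry`, standard axioms, theorems only, no new `def`)

Carriers as in `…BIJ88DirichletForms305`: a finite index type `α` of variables, regions `blk : α → I`, `Δ` a square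
matrix over a commutative ring `R`, `s : I → R`; "□_i abuts □_{i′}" is an arbitrary relation `adj : I → I → Prop`, and
the RANGE statement *"The form Δ has a range less than ½r(e_k)"* enters as the displayed hypothesis
`hΔ : blk x ≠ blk y → ¬adj (blk x) (blk y) → Δ x y = 0` (Δ couples two different regions only if they abut).
* §1 (linear algebra) **the inverse of a block-diagonal matrix is block-diagonal**: for any labelling `cls : α → K`,
  if `M x y = 0` whenever `cls x ≠ cls y`, then `M⁻¹ x y = 0` whenever `cls x ≠ cls y` (`inv_apply_eq_zero_of_blockDiag`;
  `M` commutes with every cluster projection, hence so does `M⁻¹`; no order structure on `K`; `M⁻¹` = Mathlib's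
  `Matrix.inv`, which is `0` for singular `M`, where the claim is trivial).
* §2 *"only adjacent □_j with s_j ≠ 0 interact"*: `(Δ_s)_{xy} = 0` for `x, y` in different regions unless `s_{blk x} ≠ 0`,
  `s_{blk y} ≠ 0` and `Δ_{xy} ≠ 0` (`interpForm_apply_eq_zero`); hence for every CLUSTER LABELLING `cls : I → K` constant
  along interacting pairs (`i ≠ i′`, `s_i ≠ 0`, `s_{i′} ≠ 0`, `adj i i′ ⇒ cls i = cls i′`), `Δ_s` is block-diagonal over
  `cls ∘ blk` (`interpForm_blockDiag`) and **so is `C_s = (Δ_s)^{−1}`: `C_s(x,y) = 0` unless `x, y` lie in the same cluster**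
  (`cs_apply_eq_zero_of_cluster_ne`; the same for the printed sign `(−Δ_s)^{−1}`, `cs_neg_apply_eq_zero_of_cluster_ne`).
* §3 THE TWO PRINTED FACTORIZATIONS: (a) *"also factorizes over the □_{i′}, i′ ∈ I∖Γ"* — a region with `s_{i′} = 0` is a
  cluster by itself: `C_s(x,y) = 0` if `x ∈ □_{i′}`, `y ∉ □_{i′}` or vice versa (`cs_apply_eq_zero_of_s_eq_zero`); likewise a
  Dirichlet form `Δ_Γ` decouples every `□_i`, `i ∈ Γ` (`dirichlet_inv_apply_eq_zero`); (b) *"factorizes over the connected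
  components"* — with the interaction graph `i — i′ ⟺ s_i ≠ 0 ∧ s_{i′} ≠ 0 ∧ □_i, □_{i′} abut` (Mathlib `SimpleGraph.fromRel`),
  `C_s(x,y) = 0` unless `blk x`, `blk y` are joined by a chain of interacting regions (`cs_apply_eq_zero_of_not_reachable`).
HONEST SCOPE.  Covariance level only: a Gaussian measure whose covariance is block-diagonal over the clusters is the
product of its cluster marginals, and the `f(□_i)` are local — that step (the factorization of the EXPECTATION
`∂/∂s_Γ⟨Π f(□_i)⟩_{s_Γ}` and of (5.13.3)) is not modelled here; nor are (5.13.3)–(5.13.4), `Λ₁₂^{(k)}`, the polymer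
activities.  Any commutative ring `R` (the print: `ℝ`).  NOT summit progress; NOT continuum; NOT Clay.  Imports:
`BIJ88DirichletForms305` + Mathlib's `SimpleGraph` connectivity; modifies nothing.
-/

namespace Literature.MathematicalPhysics.QuantumFieldTheory.BalabanImbrieJaffe1984to88.BIJ88CsClusters306

open scoped BigOperators Matrix
open Finset
open Literature.MathematicalPhysics.QuantumFieldTheory.BalabanImbrieJaffe1984to88
open BIJ88DirichletForms305

/-! ## §1  The inverse of a block-diagonal matrix is block-diagonal -/

section BlockDiag

variable {α K R : Type*} [Fintype α] [DecidableEq α] [CommRing R]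

/-- A matrix that does not couple different classes of a labelling `cls` commutes with every class projection.
[folklore] -/
private theorem mul_classProj_comm [DecidableEq K] (M : Matrix α α R) (cls : α → K)
    (hM : ∀ x y, cls x ≠ cls y → M x y = 0) (k : K) :
    M * Matrix.diagonal (fun z => if cls z = k then (1 : R) else 0)
      = Matrix.diagonal (fun z => if cls z = k then (1 : R) else 0) * M := by
  ext x y
  rw [Matrix.mul_diagonal, Matrix.diagonal_mul]
  by_cases hx : cls x = k
  · by_cases hy : cls y = k
    · rw [if_pos hx, if_pos hy]
      ring
    · rw [if_pos hx, if_neg hy, mul_zero, one_mul]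
      exact (hM x y (fun h => hy (h ▸ hx))).symm
  · by_cases hy : cls y = k
    · rw [if_neg hx, if_pos hy, mul_one, zero_mul]
      exact hM x y (fun h => hx (h ▸ hy))
    · rw [if_neg hx, if_neg hy, mul_zero, zero_mul]

/-- **The inverse of a block-diagonal matrix is block-diagonal** (blocks = the classes of an arbitrary labelling
`cls : α → K`): if `M x y = 0` whenever `cls x ≠ cls y`, then `M⁻¹ x y = 0` whenever `cls x ≠ cls y`.  (`M⁻¹` is
Mathlib's `Matrix.inv`; for singular `M` it is `0`.)  This is the linear algebra behind the printed *"factorizes over the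
connected components … Call the factorization regions clusters"*: the covariance inherits the cluster structure of the
inverse covariance. [cite: BalabanImbrieJaffe1988, §5.13 p.306] -/
theorem inv_apply_eq_zero_of_blockDiag (M : Matrix α α R) (cls : α → K)
    (hM : ∀ x y, cls x ≠ cls y → M x y = 0) {x y : α} (hxy : cls x ≠ cls y) : M⁻¹ x y = 0 := by
  classical
  by_cases hdet : IsUnit M.det
  · set P : Matrix α α R := Matrix.diagonal (fun z => if cls z = cls y then (1 : R) else 0) with hP
    have hcomm : M * P = P * M := mul_classProj_comm M cls hM (cls y)
    have h2 : M⁻¹ * P = P * M⁻¹ := by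
      calc M⁻¹ * P = M⁻¹ * P * (M * M⁻¹) := by rw [Matrix.mul_nonsing_inv _ hdet, Matrix.mul_one]
        _ = M⁻¹ * (P * M) * M⁻¹ := by simp only [Matrix.mul_assoc]
        _ = M⁻¹ * (M * P) * M⁻¹ := by rw [hcomm]
        _ = P * M⁻¹ := by rw [← Matrix.mul_assoc, Matrix.nonsing_inv_mul _ hdet, Matrix.one_mul]
    have h3 := congr_fun (congr_fun h2 x) y
    rw [Matrix.mul_diagonal, Matrix.diagonal_mul, if_pos rfl, if_neg hxy, mul_one, zero_mul] at h3
    exact h3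
  · rw [Matrix.nonsing_inv_apply_not_isUnit _ hdet, Matrix.zero_apply]

end BlockDiag

/-! ## §2  `Δ_s` and `C_s` are block-diagonal over the clusters -/

section Clusters

variable {α I R : Type*} [Fintype α] [DecidableEq α] [DecidableEq I] [Fintype I] [CommRing R] (blk : α → I)

/-- *"only adjacent □_j with s_j ≠ 0 interact"*: an entry of `Δ_s` between two DIFFERENT regions vanishes as soon as
one of `s_{blk x}`, `s_{blk y}`, `Δ_{xy}` does (`(Δ_s)_{xy} = s_{blk x}s_{blk y}Δ_{xy}`, `interpForm_apply`).
[cite: BalabanImbrieJaffe1988, §5.13 p.306] -/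
theorem interpForm_apply_eq_zero (Δ : Matrix α α R) (s : I → R) {x y : α} (hne : blk x ≠ blk y)
    (h : s (blk x) = 0 ∨ s (blk y) = 0 ∨ Δ x y = 0) : interpForm blk Δ s x y = 0 := by
  rw [interpForm_apply, if_neg hne]
  rcases h with h | h | h <;> simp [h]

/-- **`Δ_s` is block-diagonal over the clusters.**  With `Δ` coupling different regions only if they abut (`hΔ`, the
range statement) and a cluster labelling `cls` constant along interacting pairs (`hcls`: `i ≠ i′`, `s_i ≠ 0`,
`s_{i′} ≠ 0`, `□_i` abuts `□_{i′}` ⇒ same cluster), `(Δ_s)_{xy} = 0` for `x, y` in different clusters.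
[cite: BalabanImbrieJaffe1988, §5.13 p.306] -/
theorem interpForm_blockDiag {K : Type*} (Δ : Matrix α α R) (s : I → R) (adj : I → I → Prop)
    (hΔ : ∀ x y, blk x ≠ blk y → ¬ adj (blk x) (blk y) → Δ x y = 0) (cls : I → K)
    (hcls : ∀ i j, i ≠ j → s i ≠ 0 → s j ≠ 0 → adj i j → cls i = cls j) {x y : α}
    (hxy : cls (blk x) ≠ cls (blk y)) : interpForm blk Δ s x y = 0 := by
  have hne : blk x ≠ blk y := fun h => hxy (by rw [h])
  refine interpForm_apply_eq_zero blk Δ s hne ?_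
  by_contra hcon
  push Not at hcon
  have hadj : adj (blk x) (blk y) := by
    by_contra hadj
    exact hcon.2.2 (hΔ x y hne hadj)
  exact hxy (hcls _ _ hne hcon.1 hcon.2.1 hadj)

/-- **`C_s = (Δ_s)^{−1}` DOES NOT COUPLE DIFFERENT CLUSTERS** — the covariance behind *"factorizes over the connected
components of Γ … also factorizes over the □_{i′}, i′ ∈ I∖Γ. Call the factorization regions clusters"*: under the
hypotheses of `interpForm_blockDiag`, `C_s(x,y) = 0` for `x, y` in different clusters.
[cite: BalabanImbrieJaffe1988, §5.13 p.306] -/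
theorem cs_apply_eq_zero_of_cluster_ne {K : Type*} (Δ : Matrix α α R) (s : I → R) (adj : I → I → Prop)
    (hΔ : ∀ x y, blk x ≠ blk y → ¬ adj (blk x) (blk y) → Δ x y = 0) (cls : I → K)
    (hcls : ∀ i j, i ≠ j → s i ≠ 0 → s j ≠ 0 → adj i j → cls i = cls j) {x y : α}
    (hxy : cls (blk x) ≠ cls (blk y)) : (interpForm blk Δ s)⁻¹ x y = 0 :=
  inv_apply_eq_zero_of_blockDiag _ (cls ∘ blk)
    (fun _ _ h => interpForm_blockDiag blk Δ s adj hΔ cls hcls h) hxy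

/-- The same in the printed sign convention `C_s = (−Δ_s)^{−1}`. [cite: BalabanImbrieJaffe1988, §5.13 p.306] -/
theorem cs_neg_apply_eq_zero_of_cluster_ne {K : Type*} (Δ : Matrix α α R) (s : I → R) (adj : I → I → Prop)
    (hΔ : ∀ x y, blk x ≠ blk y → ¬ adj (blk x) (blk y) → Δ x y = 0) (cls : I → K)
    (hcls : ∀ i j, i ≠ j → s i ≠ 0 → s j ≠ 0 → adj i j → cls i = cls j) {x y : α}
    (hxy : cls (blk x) ≠ cls (blk y)) : (-interpForm blk Δ s)⁻¹ x y = 0 := by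
  refine inv_apply_eq_zero_of_blockDiag _ (cls ∘ blk) (fun x' y' h => ?_) hxy
  rw [Matrix.neg_apply, interpForm_blockDiag blk Δ s adj hΔ cls hcls h, neg_zero]

/-! ## §3  The two printed factorizations -/

/-- **(a) *"The expression also factorizes over the □_{i′}, i′ ∈ I∖Γ"*** (`s_Γ`: `s_{i′} = 0` off `Γ`): a region with
`s_{i′} = 0` is a cluster by itself — `C_s(x,y) = 0` whenever `x, y` lie in different regions one of which has `s = 0`.
No range hypothesis is needed. [cite: BalabanImbrieJaffe1988, §5.13 p.306] -/
theorem cs_apply_eq_zero_of_s_eq_zero (Δ : Matrix α α R) (s : I → R) {x y : α} (hne : blk x ≠ blk y)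
    (h0 : s (blk x) = 0 ∨ s (blk y) = 0) : (interpForm blk Δ s)⁻¹ x y = 0 := by
  rcases h0 with h0 | h0
  · -- the cluster `□_{blk x}` versus the rest
    refine inv_apply_eq_zero_of_blockDiag _ (fun z => decide (blk z = blk x)) (fun z w hzw => ?_)
      (by simpa using fun h => hne h.symm)
    have hzw' : blk z ≠ blk w := fun h => hzw (by rw [h])
    refine interpForm_apply_eq_zero blk Δ s hzw' ?_
    by_cases hz : blk z = blk x
    · exact Or.inl (hz ▸ h0)
    · have hw : blk w = blk x := by
        by_contra hw
        exact hzw (by rw [decide_eq_false hz, decide_eq_false hw])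
      exact Or.inr (Or.inl (hw ▸ h0))
  · refine inv_apply_eq_zero_of_blockDiag _ (fun z => decide (blk z = blk y)) (fun z w hzw => ?_)
      (by simpa using hne)
    have hzw' : blk z ≠ blk w := fun h => hzw (by rw [h])
    refine interpForm_apply_eq_zero blk Δ s hzw' ?_
    by_cases hz : blk z = blk y
    · exact Or.inl (hz ▸ h0)
    · have hw : blk w = blk y := by
        by_contra hw
        exact hzw (by rw [decide_eq_false hz, decide_eq_false hw])
      exact Or.inr (Or.inl (hw ▸ h0))

omit [Fintype I] in
/-- Likewise every Dirichlet form decouples each of its regions: for `i ∈ Γ`, `(Δ_Γ)^{−1}(x,y) = 0` whenever exactly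
one of `x, y` lies in `□_i` (*"inverse covariances with Dirichlet boundary conditions"*, p. 305).
[cite: BalabanImbrieJaffe1988, §5.13 p.305] -/
theorem dirichlet_inv_apply_eq_zero (Δ : Matrix α α R) (Γ : Finset I) {x y : α} (hne : blk x ≠ blk y)
    (hΓ : blk x ∈ Γ ∨ blk y ∈ Γ) : (dirichletForm blk Δ Γ)⁻¹ x y = 0 := by
  rcases hΓ with hx | hy
  · refine inv_apply_eq_zero_of_blockDiag _ (fun z => decide (blk z = blk x)) (fun z w hzw => ?_)
      (by simpa using fun h => hne h.symm)
    have hzw' : blk z ≠ blk w := fun h => hzw (by rw [h])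
    rw [dirichletForm_apply, if_neg]
    push Not
    refine ⟨hzw', fun hz => ?_⟩
    -- one of `z, w` lies in `□_{blk x} ⊆ ∪Γ`
    by_cases hzx : blk z = blk x
    · exact absurd (hzx ▸ hx) hz
    · have hw : blk w = blk x := by
        by_contra hw
        exact hzw (by rw [decide_eq_false hzx, decide_eq_false hw])
      exact hw ▸ hx
  · refine inv_apply_eq_zero_of_blockDiag _ (fun z => decide (blk z = blk y)) (fun z w hzw => ?_)
      (by simpa using hne)
    have hzw' : blk z ≠ blk w := fun h => hzw (by rw [h])
    rw [dirichletForm_apply, if_neg]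
    push Not
    refine ⟨hzw', fun hz => ?_⟩
    by_cases hzy : blk z = blk y
    · exact absurd (hzy ▸ hy) hz
    · have hw : blk w = blk y := by
        by_contra hw
        exact hzw (by rw [decide_eq_false hzy, decide_eq_false hw])
      exact hw ▸ hy

/-- **(b) *"factorizes over the connected components"***: with the INTERACTION GRAPH on the regions — `□_i — □_{i′}` iff
`s_i ≠ 0`, `s_{i′} ≠ 0` and they abut (*"only adjacent □_j with s_j ≠ 0 interact"*; Mathlib's `SimpleGraph.fromRel`,
symmetrized) — `C_s(x,y) = 0` unless the regions of `x` and `y` are joined by a chain of interacting regions, i.e.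
lie in the same connected component (cluster). [cite: BalabanImbrieJaffe1988, §5.13 p.306] -/
theorem cs_apply_eq_zero_of_not_reachable (Δ : Matrix α α R) (s : I → R) (adj : I → I → Prop)
    (hΔ : ∀ x y, blk x ≠ blk y → ¬ adj (blk x) (blk y) → Δ x y = 0) {x y : α}
    (hxy : ¬ (SimpleGraph.fromRel fun i j : I => s i ≠ 0 ∧ s j ≠ 0 ∧ adj i j).Reachable (blk x) (blk y)) :
    (interpForm blk Δ s)⁻¹ x y = 0 := by
  set G : SimpleGraph I := SimpleGraph.fromRel fun i j : I => s i ≠ 0 ∧ s j ≠ 0 ∧ adj i j with hG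
  refine cs_apply_eq_zero_of_cluster_ne blk Δ s adj hΔ G.connectedComponentMk (fun i j hij hi hj hadj => ?_)
    (fun h => hxy (SimpleGraph.ConnectedComponent.exact h))
  refine SimpleGraph.ConnectedComponent.sound (SimpleGraph.Adj.reachable ?_)
  rw [hG, SimpleGraph.fromRel_adj]
  exact ⟨hij, Or.inl ⟨hi, hj, hadj⟩⟩

/-- (b′) the same with the clusters read literally as in print — `Γ = {i : s_i ≠ 0}` and *"□_i is connected to □_{i′} if
they abut"*: if NO chain `blk x = i₀, i₁, …, i_n = blk y` of pairwise abutting regions inside `{i : s_i ≠ 0}` exists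
(reachability in the graph `fromRel (s_i ≠ 0 ∧ s_{i′} ≠ 0 ∧ adj i i′)`), the covariance entry vanishes — for the printed
sign convention `C_s = (−Δ_s)^{−1}` as well. [cite: BalabanImbrieJaffe1988, §5.13 p.306] -/
theorem cs_neg_apply_eq_zero_of_not_reachable (Δ : Matrix α α R) (s : I → R) (adj : I → I → Prop)
    (hΔ : ∀ x y, blk x ≠ blk y → ¬ adj (blk x) (blk y) → Δ x y = 0) {x y : α}
    (hxy : ¬ (SimpleGraph.fromRel fun i j : I => s i ≠ 0 ∧ s j ≠ 0 ∧ adj i j).Reachable (blk x) (blk y)) :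
    (-interpForm blk Δ s)⁻¹ x y = 0 := by
  set G : SimpleGraph I := SimpleGraph.fromRel fun i j : I => s i ≠ 0 ∧ s j ≠ 0 ∧ adj i j with hG
  refine cs_neg_apply_eq_zero_of_cluster_ne blk Δ s adj hΔ G.connectedComponentMk (fun i j hij hi hj hadj => ?_)
    (fun h => hxy (SimpleGraph.ConnectedComponent.exact h))
  refine SimpleGraph.ConnectedComponent.sound (SimpleGraph.Adj.reachable ?_)
  rw [hG, SimpleGraph.fromRel_adj]
  exact ⟨hij, Or.inl ⟨hi, hj, hadj⟩⟩

end Clusters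

end Literature.MathematicalPhysics.QuantumFieldTheory.BalabanImbrieJaffe1984to88.BIJ88CsClusters306
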